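import Summits.AtomisticToContinuum.HydrodynamicLimit.Theorems.CollisionIsometryCLTHsFreeEnergyConvexBasic
import Literature.Analysis.FluidPDE.HardSphereTorusMeasure
import HarnessLib

/-!
# Sub-cube decomposition of the hard-sphere free volume: the product lower bound over cells

Stub `fv_cells_product_lower` (S2) of the line `IdeatorTwoGen1Sketch` for the crux
`CollisionIsometryCLT.MacroClosure` (item stmt-AtomisticToContinuum-14870), wave 3 (statics input
`stub_hsFreeEnergyConvex`, Ruelle convexity of the hard-sphere free-energy density).

Let `ι` label `N` particles on the flat torus `T3`, let `(C j)_{j ∈ T}` be measurable cells that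
are pairwise `d`-separated in the minimal-image distance (`d > 0`), and let `n j` be prescribed
occupation numbers with `∑_{j ∈ T} n j = N`. Writing
`W j = vol {x : Fin (n j) → T3 | ∀ i, x i ∈ C j, pairwise d ≤ dist}` for the constrained
non-overlap volume of `n j` labelled points in the cell `C j`, we prove the **product lower bound**

`N! / (∏_j (n j)!) · ∏_j W j ≤ vol {q : ι → T3 | (∀ i, ∃ j ∈ T, q i ∈ C j) ∧ pairwise d ≤ dist}`

(the multinomial weight is the entropy of mixing of the labels over the cells).

Proof: induction on the cells. Peeling a cell `C j₀` with occupation `a = n j₀`, for every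
`a`-subset `S` of the labels the configurations with exactly the labels `S` in `C j₀` and the
others in the remaining cells form pairwise disjoint (cells are disjoint) measurable subsets of
the target set; splitting `ι → T3` along `S` (`MeasurableEquiv.piEquivPiSubtypeProd`, measure
preserving) each of them is a product set — cross pairs are separated by hypothesis — of volume
`W j₀ ×` (volume of the smaller problem on the complement of `S`), after relabelling the fibre
`{i // i ∈ S} ≃ Fin a` (`MeasurableEquiv.piCongrLeft`). Summing over the `N choose a` subsets and
using `(N choose a) · (N - a)! = N! / a!` closes the induction.

Reference: D. Ruelle, *Statistical Mechanics: Rigorous Results* (1969), §3.4 (sub-cube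
decomposition / entropy of mixing in the proof of convexity of the free energy).
-/

noncomputable section

open MeasureTheory Filter Set Topology
open scoped ENNReal

namespace Summit.AtomisticToContinuum.HydrodynamicLimit.Theorems.MacroClosureLine

open Literature.MathematicalPhysics.KineticTheory Literature.Analysis.FluidPDE
open Literature.Analysis.FunctionSpaces

namespace Barycentric

namespace FvCellsProduct

/-! ### Measurability of the constraint sets -/

/-- A set cut out by implications `P i → q ∈ B i` over a countable index type, with `B i`
measurable whenever `P i` holds, is measurable. [folklore] -/
theorem measurableSet_forall_imp {ι X : Type} [Countable ι] [MeasurableSpace X] (P : ι → Prop)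
    (B : ι → Set X) (hB : ∀ i, P i → MeasurableSet (B i)) :
    MeasurableSet {q : X | ∀ i, P i → q ∈ B i} := by
  have e : {q : X | ∀ i, P i → q ∈ B i} = ⋂ i, {q : X | P i → q ∈ B i} := by
    ext q
    simp
  rw [e]
  refine MeasurableSet.iInter fun i => ?_
  by_cases hi : P i
  · have e1 : {q : X | P i → q ∈ B i} = B i := by
      ext q
      simp [hi]
    rw [e1]
    exact hB i hi
  · have e1 : {q : X | P i → q ∈ B i} = univ := by
      ext q
      simp [hi]
    rw [e1]
    exact MeasurableSet.univ

/-- The non-overlap constraint `∀ i ≠ i', d ≤ dist (q i) (q i')` defines a measurable set of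
configurations `ι → T3` (each pair constraint is a closed condition). [folklore] -/
theorem measurableSet_sep {ι : Type} [Fintype ι] (d : ℝ) :
    MeasurableSet {q : ι → T3 | ∀ i i', i ≠ i' → d ≤ Torus.euclidDist (q i) (q i')} := by
  have h : {q : ι → T3 | ∀ i i', i ≠ i' → d ≤ Torus.euclidDist (q i) (q i')} =
      ⋂ i, {q : ι → T3 | ∀ i', i ≠ i' →
        q ∈ {q : ι → T3 | d ≤ Torus.euclidDist (q i) (q i')}} := by
    ext q
    simp
  rw [h]
  refine MeasurableSet.iInter fun i => measurableSet_forall_imp _ _ fun i' _ => ?_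
  exact measurableSet_le measurable_const (continuous_euclidDist_apply (d := Fin 3) i i').measurable

/-- The constraint "coordinate `i` lies in one of the cells `C j`, `j ∈ T`" is measurable.
[folklore] -/
theorem measurableSet_exists_mem {ι κ : Type} (T : Finset κ) (C : κ → Set T3)
    (hC : ∀ j ∈ T, MeasurableSet (C j)) (i : ι) :
    MeasurableSet {q : ι → T3 | ∃ j ∈ T, q i ∈ C j} := by
  have e : {q : ι → T3 | ∃ j ∈ T, q i ∈ C j} = ⋃ j ∈ T, (fun q : ι → T3 => q i) ⁻¹' C j := by
    ext q
    simp
  rw [e]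
  exact Finset.measurableSet_biUnion T fun j hj => (hC j hj).preimage (measurable_pi_apply i)

/-- The set of configurations with the labels of `S` in the cell `A`, the other labels in the
cells `C j`, `j ∈ T`, and no overlap, is measurable. [folklore] -/
theorem measurableSet_labelled {ι κ : Type} [Fintype ι] (S : Finset ι) (T : Finset κ)
    (C : κ → Set T3) (A : Set T3) (hA : MeasurableSet A) (hC : ∀ j ∈ T, MeasurableSet (C j))
    (d : ℝ) :
    MeasurableSet {q : ι → T3 | (∀ i, i ∈ S → q i ∈ A) ∧ (∀ i, i ∉ S → ∃ j ∈ T, q i ∈ C j) ∧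
      ∀ i i', i ≠ i' → d ≤ Torus.euclidDist (q i) (q i')} := by
  have h1 : MeasurableSet {q : ι → T3 | ∀ i, i ∈ S → q ∈ (fun q : ι → T3 => q i) ⁻¹' A} :=
    measurableSet_forall_imp _ _ fun i _ => hA.preimage (measurable_pi_apply i)
  have h2 : MeasurableSet {q : ι → T3 | ∀ i, i ∉ S → q ∈ {q : ι → T3 | ∃ j ∈ T, q i ∈ C j}} :=
    measurableSet_forall_imp _ _ fun i _ => measurableSet_exists_mem T C hC i
  exact h1.inter (h2.inter (measurableSet_sep d))

/-! ### Disjointness and containment of the labelled pieces -/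

/-- A point of the cell `A` lies in none of the cells `C j`, `j ∈ T`, when `A` is `d`-separated
from them with `d > 0`. [folklore] -/
theorem not_exists_mem_of_mem {κ : Type} {T : Finset κ} {C : κ → Set T3} {A : Set T3} {d : ℝ}
    (hd : 0 < d)
    (hsep : ∀ j ∈ T, ∀ x ∈ A, ∀ y ∈ C j, d ≤ Torus.euclidDist x y ∧ d ≤ Torus.euclidDist y x)
    {x : T3} (hx : x ∈ A) : ¬∃ j ∈ T, x ∈ C j := by
  rintro ⟨j, hj, hx'⟩
  have h := (hsep j hj x hx x hx').1
  rw [Torus.euclidDist_self] at h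
  exact absurd h (not_le.2 hd)

/-- The labelled pieces for two different label sets `S ≠ S'` are disjoint. [folklore] -/
theorem disjoint_labelled {ι κ : Type} {S S' : Finset ι} (hSS' : S ≠ S') (T : Finset κ)
    (C : κ → Set T3) (A : Set T3) {d : ℝ} (hd : 0 < d)
    (hsep : ∀ j ∈ T, ∀ x ∈ A, ∀ y ∈ C j, d ≤ Torus.euclidDist x y ∧ d ≤ Torus.euclidDist y x) :
    Disjoint {q : ι → T3 | (∀ i, i ∈ S → q i ∈ A) ∧ (∀ i, i ∉ S → ∃ j ∈ T, q i ∈ C j) ∧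
        ∀ i i', i ≠ i' → d ≤ Torus.euclidDist (q i) (q i')}
      {q : ι → T3 | (∀ i, i ∈ S' → q i ∈ A) ∧ (∀ i, i ∉ S' → ∃ j ∈ T, q i ∈ C j) ∧
        ∀ i i', i ≠ i' → d ≤ Torus.euclidDist (q i) (q i')} := by
  rw [Set.disjoint_left]
  rintro q ⟨hA, hC, -⟩ ⟨hA', hC', -⟩
  obtain ⟨i, hi⟩ : ∃ i, ¬(i ∈ S ↔ i ∈ S') := not_forall.1 fun h => hSS' (Finset.ext h)
  by_cases hiS : i ∈ S
  · have hiS' : i ∉ S' := fun h => hi ⟨fun _ => h, fun _ => hiS⟩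
    exact not_exists_mem_of_mem hd hsep (hA i hiS) (hC' i hiS')
  · have hiS' : i ∈ S' := by
      by_contra h
      exact hi ⟨fun h' => absurd h' hiS, fun h' => absurd h' h⟩
    exact not_exists_mem_of_mem hd hsep (hA' i hiS') (hC i hiS)

/-- Each labelled piece (labels of `S` in `C j₀`, the others in the cells of `T`) is contained in
the target set for the cells of `insert j₀ T`. [folklore] -/
theorem labelled_subset {ι κ : Type} [DecidableEq κ] (S : Finset ι) (T : Finset κ) (j₀ : κ)
    (C : κ → Set T3) (d : ℝ) :
    {q : ι → T3 | (∀ i, i ∈ S → q i ∈ C j₀) ∧ (∀ i, i ∉ S → ∃ j ∈ T, q i ∈ C j) ∧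
        ∀ i i', i ≠ i' → d ≤ Torus.euclidDist (q i) (q i')} ⊆
      {q : ι → T3 | (∀ i, ∃ j ∈ insert j₀ T, q i ∈ C j) ∧
        ∀ i i', i ≠ i' → d ≤ Torus.euclidDist (q i) (q i')} := by
  rintro q ⟨hA, hC, hP⟩
  refine ⟨fun i => ?_, hP⟩
  by_cases hi : i ∈ S
  · exact ⟨j₀, Finset.mem_insert_self _ _, hA i hi⟩
  · obtain ⟨j, hj, h⟩ := hC i hi
    exact ⟨j, Finset.mem_insert_of_mem hj, h⟩

/-- Summing the volumes of the (disjoint, measurable) labelled pieces over any family of label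
sets bounds the volume of the target set from below. [folklore] -/
theorem sum_volume_labelled_le {ι κ : Type} [Fintype ι] [DecidableEq κ] (PC : Finset (Finset ι))
    (T : Finset κ) (j₀ : κ) (C : κ → Set T3) {d : ℝ} (hd : 0 < d) (hA : MeasurableSet (C j₀))
    (hC : ∀ j ∈ T, MeasurableSet (C j))
    (hsep : ∀ j ∈ T, ∀ x ∈ C j₀, ∀ y ∈ C j, d ≤ Torus.euclidDist x y ∧ d ≤ Torus.euclidDist y x) :
    ∑ S ∈ PC, (volume {q : ι → T3 | (∀ i, i ∈ S → q i ∈ C j₀) ∧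
        (∀ i, i ∉ S → ∃ j ∈ T, q i ∈ C j) ∧
          ∀ i i', i ≠ i' → d ≤ Torus.euclidDist (q i) (q i')}).toReal ≤
      (volume {q : ι → T3 | (∀ i, ∃ j ∈ insert j₀ T, q i ∈ C j) ∧
        ∀ i i', i ≠ i' → d ≤ Torus.euclidDist (q i) (q i')}).toReal := by
  rw [← ENNReal.toReal_sum (fun S _ => measure_ne_top _ _), ← measure_biUnion_finset]
  · refine ENNReal.toReal_mono (measure_ne_top _ _) (measure_mono ?_)
    exact Set.iUnion₂_subset fun S _ => labelled_subset S T j₀ C d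
  · exact fun S _ S' _ hne => disjoint_labelled hne T C (C j₀) hd hsep
  · exact fun S _ => measurableSet_labelled S T C (C j₀) hA hC d

/-! ### The product structure of a labelled piece -/

/-- **Splitting along a label set.** Under `MeasurableEquiv.piEquivPiSubtypeProd` the labelled
piece for the predicate `p` is the product of the constrained non-overlap set of the `p`-labels
in `A` and of the target set of the remaining labels in the cells of `T` (cross pairs are
separated by hypothesis), so its volume factorises. [folklore] -/
theorem volume_split {ι κ : Type} [Fintype ι] (p : ι → Prop) [DecidablePred p] (T : Finset κ)
    (C : κ → Set T3) (A : Set T3) (d : ℝ)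
    (hsep : ∀ j ∈ T, ∀ x ∈ A, ∀ y ∈ C j, d ≤ Torus.euclidDist x y ∧ d ≤ Torus.euclidDist y x) :
    volume {q : ι → T3 | (∀ i, p i → q i ∈ A) ∧ (∀ i, ¬p i → ∃ j ∈ T, q i ∈ C j) ∧
        ∀ i i', i ≠ i' → d ≤ Torus.euclidDist (q i) (q i')} =
      volume {x : {i // p i} → T3 | (∀ i, x i ∈ A) ∧
          ∀ i i', i ≠ i' → d ≤ Torus.euclidDist (x i) (x i')} *
        volume {y : {i // ¬p i} → T3 | (∀ i, ∃ j ∈ T, y i ∈ C j) ∧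
          ∀ i i', i ≠ i' → d ≤ Torus.euclidDist (y i) (y i')} := by
  have hmp : MeasurePreserving (MeasurableEquiv.piEquivPiSubtypeProd (fun _ : ι => T3) p)
      (volume : Measure (ι → T3))
      ((volume : Measure ({i // p i} → T3)).prod (volume : Measure ({i // ¬p i} → T3))) :=
    volume_preserving_piEquivPiSubtypeProd (fun _ : ι => T3) p
  have hset : {q : ι → T3 | (∀ i, p i → q i ∈ A) ∧ (∀ i, ¬p i → ∃ j ∈ T, q i ∈ C j) ∧
        ∀ i i', i ≠ i' → d ≤ Torus.euclidDist (q i) (q i')} =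
      MeasurableEquiv.piEquivPiSubtypeProd (fun _ : ι => T3) p ⁻¹'
        ({x : {i // p i} → T3 | (∀ i, x i ∈ A) ∧
            ∀ i i', i ≠ i' → d ≤ Torus.euclidDist (x i) (x i')} ×ˢ
          {y : {i // ¬p i} → T3 | (∀ i, ∃ j ∈ T, y i ∈ C j) ∧
            ∀ i i', i ≠ i' → d ≤ Torus.euclidDist (y i) (y i')}) := by
    ext q
    simp only [Set.mem_setOf_eq, Set.mem_preimage, Set.mem_prod,
      MeasurableEquiv.piEquivPiSubtypeProd_apply]
    constructor
    · rintro ⟨hA, hC, hP⟩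
      exact ⟨⟨fun i => hA i i.2, fun i i' hii' => hP i i' fun h => hii' (Subtype.ext h)⟩,
        ⟨fun i => hC i i.2, fun i i' hii' => hP i i' fun h => hii' (Subtype.ext h)⟩⟩
    · rintro ⟨⟨hA, hPA⟩, ⟨hC, hPC⟩⟩
      refine ⟨fun i hi => hA ⟨i, hi⟩, fun i hi => hC ⟨i, hi⟩, fun i i' hii' => ?_⟩
      by_cases hi : p i <;> by_cases hi' : p i'
      · exact hPA ⟨i, hi⟩ ⟨i', hi'⟩ fun h => hii' (congrArg Subtype.val h)
      · obtain ⟨j, hj, hy⟩ := hC ⟨i', hi'⟩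
        exact (hsep j hj _ (hA ⟨i, hi⟩) _ hy).1
      · obtain ⟨j, hj, hx⟩ := hC ⟨i, hi⟩
        exact (hsep j hj _ (hA ⟨i', hi'⟩) _ hx).2
      · exact hPC ⟨i, hi⟩ ⟨i', hi'⟩ fun h => hii' (congrArg Subtype.val h)
  rw [hset, hmp.measure_preimage_equiv, Measure.prod_prod]

/-- **Relabelling.** The volume of the constrained non-overlap set of labelled points in a cell
only depends on the number of labels (`MeasurableEquiv.piCongrLeft` along `α ≃ β` preserves the
product Haar measure). [folklore] -/
theorem volume_relabel {α β : Type} [Fintype α] [Fintype β] (e : α ≃ β) (A : Set T3) (d : ℝ) :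
    volume {x : α → T3 | (∀ i, x i ∈ A) ∧ ∀ i i', i ≠ i' → d ≤ Torus.euclidDist (x i) (x i')} =
      volume {x : β → T3 | (∀ i, x i ∈ A) ∧
        ∀ i i', i ≠ i' → d ≤ Torus.euclidDist (x i) (x i')} := by
  have hmp : MeasurePreserving (MeasurableEquiv.piCongrLeft (fun _ : β => T3) e)
      (volume : Measure (α → T3)) (volume : Measure (β → T3)) :=
    volume_measurePreserving_piCongrLeft (fun _ : β => T3) e
  rw [← hmp.measure_preimage_equiv]
  congr 1
  ext x
  simp only [Set.mem_setOf_eq, Set.mem_preimage, MeasurableEquiv.coe_piCongrLeft,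
    Equiv.piCongrLeft_apply_eq_cast, cast_eq]
  constructor
  · rintro ⟨hA, hP⟩
    exact ⟨fun b => hA (e.symm b), fun b b' hbb' => hP _ _ fun h => hbb' (e.symm.injective h)⟩
  · rintro ⟨hA, hP⟩
    refine ⟨fun a => ?_, fun a a' haa' => ?_⟩
    · simpa using hA (e a)
    · simpa using hP (e a) (e a') fun h => haa' (e.injective h)

/-- **One term of the peeling step.** For a label predicate `p` with `a` labels, the volume of
the labelled piece is at least `W(a, A) · c`, where `W(a, A)` is the constrained non-overlap
volume of `a` points in `A` and `c` is any lower bound for the smaller problem on the remaining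
`m = N - a` labels (the induction hypothesis). [folklore] -/
theorem term_lower {ι κ : Type} [Fintype ι] [DecidableEq ι] (p : ι → Prop) [DecidablePred p]
    (T : Finset κ) (C : κ → Set T3) (A : Set T3) (d : ℝ) (a m : ℕ) (c : ℝ)
    (hsep : ∀ j ∈ T, ∀ x ∈ A, ∀ y ∈ C j, d ≤ Torus.euclidDist x y ∧ d ≤ Torus.euclidDist y x)
    (ha : (Finset.univ.filter p).card = a) (hm : Fintype.card ι = a + m)
    (hIH : ∀ (ι' : Type) [Fintype ι'] [DecidableEq ι'], Fintype.card ι' = m →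
      c ≤ (volume {q : ι' → T3 | (∀ i, ∃ j ∈ T, q i ∈ C j) ∧
        ∀ i i', i ≠ i' → d ≤ Torus.euclidDist (q i) (q i')}).toReal) :
    (volume {x : Fin a → T3 | (∀ i, x i ∈ A) ∧
        ∀ i i', i ≠ i' → d ≤ Torus.euclidDist (x i) (x i')}).toReal * c ≤
      (volume {q : ι → T3 | (∀ i, p i → q i ∈ A) ∧ (∀ i, ¬p i → ∃ j ∈ T, q i ∈ C j) ∧
        ∀ i i', i ≠ i' → d ≤ Torus.euclidDist (q i) (q i')}).toReal := by
  have hcardp : Fintype.card {i // p i} = a := by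
    rw [Fintype.card_subtype]
    exact ha
  have hcardn : Fintype.card {i // ¬p i} = m := by
    rw [Fintype.card_subtype_compl, hcardp, hm, Nat.add_sub_cancel_left]
  rw [volume_split p T C A d hsep, ENNReal.toReal_mul,
    volume_relabel (Fintype.equivFinOfCardEq hcardp) A d]
  exact mul_le_mul_of_nonneg_left (hIH {i // ¬p i} hcardn) ENNReal.toReal_nonneg

/-! ### The induction on the cells -/

/-- The product lower bound, by induction on the finite set of cells (generalised over the label
type). [cite: Ruelle1969, §3.4] -/
theorem cells_product_lower_aux {κ : Type} [DecidableEq κ] (C : κ → Set T3) (n : κ → ℕ) {d : ℝ}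
    (hd : 0 < d) (T : Finset κ) :
    ∀ (ι : Type) [Fintype ι] [DecidableEq ι],
      (∀ j ∈ T, MeasurableSet (C j)) →
      (∀ j ∈ T, ∀ j' ∈ T, j ≠ j' → ∀ x ∈ C j, ∀ y ∈ C j', d ≤ Torus.euclidDist x y) →
      ∑ j ∈ T, n j = Fintype.card ι →
      ((Fintype.card ι).factorial : ℝ) / (∏ j ∈ T, ((n j).factorial : ℝ)) *
          ∏ j ∈ T, (volume {x : Fin (n j) → T3 | (∀ i, x i ∈ C j) ∧
            ∀ i i', i ≠ i' → d ≤ Torus.euclidDist (x i) (x i')}).toReal ≤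
        (volume {q : ι → T3 | (∀ i, ∃ j ∈ T, q i ∈ C j) ∧
          ∀ i i', i ≠ i' → d ≤ Torus.euclidDist (q i) (q i')}).toReal := by
  induction T using Finset.induction_on with
  | empty =>
    intro ι _ _ _ _ hsum
    rw [Finset.sum_empty] at hsum
    haveI : IsEmpty ι := Fintype.card_eq_zero_iff.1 hsum.symm
    have hset : {q : ι → T3 | (∀ i, ∃ j ∈ (∅ : Finset κ), q i ∈ C j) ∧
        ∀ i i', i ≠ i' → d ≤ Torus.euclidDist (q i) (q i')} = univ :=
      Set.eq_univ_iff_forall.2 fun _ => ⟨fun i => isEmptyElim i, fun i => isEmptyElim i⟩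
    have huniv : (volume : Measure (ι → T3)) univ = 1 := by
      show Measure.pi (fun _ : ι => (volume : Measure T3)) univ = 1
      exact measure_univ
    rw [hset, Finset.prod_empty, Finset.prod_empty, ← hsum, Nat.factorial_zero, Nat.cast_one,
      div_one, one_mul, huniv, ENNReal.toReal_one]
  | insert j₀ T hj₀ ih =>
    intro ι _ _ hmeas hsep hsum
    rw [Finset.sum_insert hj₀] at hsum
    -- data of the peeled cell (`a = n j₀` labels go to `C j₀`, `m` labels remain)
    set m : ℕ := ∑ j ∈ T, n j with hm_def
    set N : ℕ := Fintype.card ι with hN_def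
    have hmeasT : ∀ j ∈ T, MeasurableSet (C j) := fun j hj => hmeas j (Finset.mem_insert_of_mem hj)
    have hsepT : ∀ j ∈ T, ∀ j' ∈ T, j ≠ j' → ∀ x ∈ C j, ∀ y ∈ C j', d ≤ Torus.euclidDist x y :=
      fun j hj j' hj' => hsep j (Finset.mem_insert_of_mem hj) j' (Finset.mem_insert_of_mem hj')
    have hsepA : ∀ j ∈ T, ∀ x ∈ C j₀, ∀ y ∈ C j,
        d ≤ Torus.euclidDist x y ∧ d ≤ Torus.euclidDist y x := by
      intro j hj x hx y hy
      have hne : j₀ ≠ j := fun h => hj₀ (h ▸ hj)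
      exact ⟨hsep j₀ (Finset.mem_insert_self _ _) j (Finset.mem_insert_of_mem hj) hne x hx y hy,
        hsep j (Finset.mem_insert_of_mem hj) j₀ (Finset.mem_insert_self _ _) hne.symm y hy x hx⟩
    -- the induction hypothesis as a uniform lower bound `c` on `m` labels
    set c : ℝ := ((m.factorial : ℝ)) / (∏ j ∈ T, ((n j).factorial : ℝ)) *
      ∏ j ∈ T, (volume {x : Fin (n j) → T3 | (∀ i, x i ∈ C j) ∧
        ∀ i i', i ≠ i' → d ≤ Torus.euclidDist (x i) (x i')}).toReal with hc_def
    have hIH : ∀ (ι' : Type) [Fintype ι'] [DecidableEq ι'], Fintype.card ι' = m →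
        c ≤ (volume {q : ι' → T3 | (∀ i, ∃ j ∈ T, q i ∈ C j) ∧
          ∀ i i', i ≠ i' → d ≤ Torus.euclidDist (q i) (q i')}).toReal := by
      intro ι' _ _ hcard
      have h := ih ι' hmeasT hsepT hcard.symm
      rw [hcard] at h
      exact h
    -- the cell factor of the peeled cell
    set W₀ : ℝ := (volume {x : Fin (n j₀) → T3 | (∀ i, x i ∈ C j₀) ∧
      ∀ i i', i ≠ i' → d ≤ Torus.euclidDist (x i) (x i')}).toReal with hW₀_def
    -- each `a`-subset of labels contributes at least `W₀ * c`
    have hterm : ∀ S ∈ (Finset.univ : Finset ι).powersetCard (n j₀),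
        W₀ * c ≤ (volume {q : ι → T3 | (∀ i, i ∈ S → q i ∈ C j₀) ∧
          (∀ i, i ∉ S → ∃ j ∈ T, q i ∈ C j) ∧
            ∀ i i', i ≠ i' → d ≤ Torus.euclidDist (q i) (q i')}).toReal := by
      intro S hS
      have hSa : (Finset.univ.filter fun i => i ∈ S).card = n j₀ := by
        rw [Finset.filter_univ_mem]
        exact (Finset.mem_powersetCard.1 hS).2
      exact term_lower (fun i => i ∈ S) T C (C j₀) d (n j₀) m c hsepA hSa hsum.symm hIH
    -- counting the subsets and the multinomial arithmetic
    have hcardPC : (((Finset.univ : Finset ι).powersetCard (n j₀)).card : ℝ) =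
        (N.choose (n j₀) : ℝ) := by
      rw [Finset.card_powersetCard, Finset.card_univ]
    have hsub : N - n j₀ = m := by omega
    have hch : ((N.choose (n j₀) : ℕ) : ℝ) * ((n j₀).factorial : ℝ) * (m.factorial : ℝ) =
        (N.factorial : ℝ) := by
      have h := Nat.choose_mul_factorial_mul_factorial (show n j₀ ≤ N by omega)
      rw [hsub] at h
      exact_mod_cast h
    have ha0 : ((n j₀).factorial : ℝ) ≠ 0 := Nat.cast_ne_zero.2 (Nat.factorial_ne_zero _)
    have hm0 : (m.factorial : ℝ) ≠ 0 := Nat.cast_ne_zero.2 (Nat.factorial_ne_zero m)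
    have hPT : (∏ j ∈ T, ((n j).factorial : ℝ)) ≠ 0 :=
      Finset.prod_ne_zero_iff.2 fun j _ => Nat.cast_ne_zero.2 (Nat.factorial_ne_zero _)
    have key : ((N.factorial : ℝ)) / (∏ j ∈ insert j₀ T, ((n j).factorial : ℝ)) *
        ∏ j ∈ insert j₀ T, (volume {x : Fin (n j) → T3 | (∀ i, x i ∈ C j) ∧
          ∀ i i', i ≠ i' → d ≤ Torus.euclidDist (x i) (x i')}).toReal =
        (N.choose (n j₀) : ℝ) * (W₀ * c) := by
      rw [Finset.prod_insert hj₀, Finset.prod_insert hj₀, ← hch]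
      simp only [hc_def, hW₀_def]
      field_simp
    calc ((N.factorial : ℝ)) / (∏ j ∈ insert j₀ T, ((n j).factorial : ℝ)) *
          ∏ j ∈ insert j₀ T, (volume {x : Fin (n j) → T3 | (∀ i, x i ∈ C j) ∧
            ∀ i i', i ≠ i' → d ≤ Torus.euclidDist (x i) (x i')}).toReal
        = (N.choose (n j₀) : ℝ) * (W₀ * c) := key
      _ = ∑ _S ∈ (Finset.univ : Finset ι).powersetCard (n j₀), W₀ * c := by
        rw [Finset.sum_const, nsmul_eq_mul, hcardPC]
      _ ≤ ∑ S ∈ (Finset.univ : Finset ι).powersetCard (n j₀),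
            (volume {q : ι → T3 | (∀ i, i ∈ S → q i ∈ C j₀) ∧
              (∀ i, i ∉ S → ∃ j ∈ T, q i ∈ C j) ∧
                ∀ i i', i ≠ i' → d ≤ Torus.euclidDist (q i) (q i')}).toReal :=
        Finset.sum_le_sum hterm
      _ ≤ (volume {q : ι → T3 | (∀ i, ∃ j ∈ insert j₀ T, q i ∈ C j) ∧
            ∀ i i', i ≠ i' → d ≤ Torus.euclidDist (q i) (q i')}).toReal :=
        sum_volume_labelled_le _ T j₀ C hd (hmeas j₀ (Finset.mem_insert_self _ _)) hmeasT hsepA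

end FvCellsProduct

/-- **Product lower bound over separated cells** (S2 of the sub-cube decomposition): for
measurable cells `C j`, `j ∈ T`, of the flat torus that are pairwise `d`-separated (`d > 0`) in
the minimal-image distance, and occupation numbers `n j` with `∑_{j ∈ T} n j = N = card ι`, the
Haar volume of the labelled non-overlap set of `N` points lying in the cells is at least the
multinomial weight `N! / ∏ (n j)!` times the product of the constrained non-overlap volumes of
`n j` points in the single cells. [cite: Ruelle1969, §3.4] -/
theorem fv_cells_product_lower : ∀ (ι κ : Type) [Fintype ι] [DecidableEq ι] [DecidableEq κ]
    (T : Finset κ) (C : κ → Set T3) (n : κ → ℕ) (d : ℝ), 0 < d → (∀ j ∈ T, MeasurableSet (C j)) →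
    (∀ j ∈ T, ∀ j' ∈ T, j ≠ j' → ∀ x ∈ C j, ∀ y ∈ C j', d ≤ Torus.euclidDist x y) →
    ∑ j ∈ T, n j = Fintype.card ι →
    ((Fintype.card ι).factorial : ℝ) / (∏ j ∈ T, ((n j).factorial : ℝ)) *
        ∏ j ∈ T, (volume {x : Fin (n j) → T3 | (∀ i, x i ∈ C j) ∧
          ∀ i i', i ≠ i' → d ≤ Torus.euclidDist (x i) (x i')}).toReal ≤
      (volume {q : ι → T3 | (∀ i, ∃ j ∈ T, q i ∈ C j) ∧
        ∀ i i', i ≠ i' → d ≤ Torus.euclidDist (q i) (q i')}).toReal := by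
  intro ι κ _ _ _ T C n d hd hmeas hsep hsum
  exact FvCellsProduct.cells_product_lower_aux C n hd T ι hmeas hsep hsum

end Barycentric

end Summit.AtomisticToContinuum.HydrodynamicLimit.Theorems.MacroClosureLine

end
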